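import Literature.NumberTheory.Automorphic.MeyerRatDivisibility
import Literature.NumberTheory.Automorphic.MeyerThetaMellin
import Mathlib.NumberTheory.LSeries.AbstractFuncEq
import Mathlib.Analysis.Fourier.PoissonSummation
import Mathlib.Analysis.Distribution.SchwartzSpace.Fourier
import HarnessLib

/-!
# Meyer's global difference representation — proofs, `K = ℚ`: the functional equation of the
# theta Mellin transform `2 ζ(z) Mk(z)` for an even Schwartz function `k`

Topic `NumberTheory/Automorphic`; namespace `Literature.NumberTheory.Automorphic.Meyer`. Sibling
PROOF file for Step E of the plan for `Meyer.spectralRealisation_rat` [Meyer2005, Thm. 5.11]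
(the left half plane `Re s ≤ 0`, reached in [Meyer2005] through the Fourier symmetry `J𝔉`).
For an even Schwartz function `k` on `ℝ`, the theta function `Θ_k(x) = ∑_{n ∈ ℤ} k(nx)`
satisfies `Θ_k(1/x) = x Θ_{𝓕k}(x)` (Poisson summation, Mathlib), so by Mathlib's abstract
functional-equation machinery (`WeakFEPair`) the function `2 ζ(z) Mk(z) = 𝓜(Θ_k - k(0))(z)`
(`Re z > 1`) has a meromorphic continuation `Λ_k` with `Λ_k(1 - z) = Λ_{𝓕k}(z)`; when
`k(0) = 0 = 𝓕k(0)` both are entire.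

* `fourier_scaleSchwartz`, `tsum_int_dilate_eq` — Fourier transform and Poisson summation for dilations;
* `thetaPair k` — the `WeakFEPair` attached to `k`;
* `thetaPair_Λ_eq` — `Λ_k(z) = 2 ζ(z) Mk(z)` for `Re z > 1`;
* `exists_entire_thetaFE` — for even `k` with `k(0) = 0 = ∫ k`: entire `Λ, Λ'` with
  `Λ = 2ζ·Mk`, `Λ' = 2ζ·M(𝓕k)` on `Re z > 1` and `Λ(1 - z) = Λ'(z)`.

## References

* R. Meyer, *On a representation of the idele class group related to primes and zeros of
  L-functions*, Duke Math. J. 127 (2005) = arXiv:math/0311468, §5.7 [Meyer2005].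
* J. Tate, *Fourier analysis in number fields and Hecke's zeta-functions* (1950), §2.5 (local
  functional equation at the real place).
-/

noncomputable section

open MeasureTheory Set Filter Complex NumberField Asymptotics
open scoped Topology Real FourierTransform

namespace Literature.NumberTheory.Automorphic.Meyer

/-! ### Fourier transform and Poisson summation for dilations -/

section Dilation

/-- The dilation `t ↦ G (c t)` of a Schwartz function (`c ≠ 0`), as a Schwartz function. [folklore] -/
def scaleSchwartz (c : ℝ) (hc : c ≠ 0) (G : SchwartzMap ℝ ℂ) : SchwartzMap ℝ ℂ :=
  SchwartzMap.compCLMOfContinuousLinearEquiv ℂ (ContinuousLinearEquiv.unitsEquivAut ℝ (Units.mk0 c hc)) G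

/-- Values of the dilation. [folklore] -/
@[simp]
theorem scaleSchwartz_apply (c : ℝ) (hc : c ≠ 0) (G : SchwartzMap ℝ ℂ) (t : ℝ) : scaleSchwartz c hc G t = G (c * t) := by
  rw [scaleSchwartz, SchwartzMap.compCLMOfContinuousLinearEquiv_apply, Function.comp_apply,
    ContinuousLinearEquiv.unitsEquivAut_apply, Units.val_mk0, mul_comm]

/-- Mellin transforms of functions agreeing on `(0, ∞)` agree. [folklore] -/
theorem mellin_congr_Ioi' {f g : ℝ → ℂ} (h : ∀ t : ℝ, 0 < t → f t = g t) (z : ℂ) : mellin f z = mellin g z := by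
  rw [mellin, mellin]
  exact setIntegral_congr_fun measurableSet_Ioi fun t ht => by rw [h t ht]

variable (k : SchwartzMap ℝ ℂ)

/-- `𝓕(k(c·))(ξ) = c⁻¹ 𝓕k(ξ/c)` for `c > 0`. [folklore] -/
theorem fourier_scaleSchwartz {c : ℝ} (hc : 0 < c) (ξ : ℝ) :
    𝓕 (⇑(scaleSchwartz c hc.ne' k)) ξ = (c⁻¹ : ℂ) * 𝓕 (⇑k) (ξ / c) := by
  rw [Real.fourier_real_eq_integral_exp_smul, Real.fourier_real_eq_integral_exp_smul]
  simp only [scaleSchwartz_apply, smul_eq_mul]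
  have h := Measure.integral_comp_mul_left (fun u : ℝ => cexp (↑(-2 * π * (u / c) * ξ) * I) * k u) c
  have hfun : (fun x : ℝ => cexp (↑(-2 * π * (c * x / c) * ξ) * I) * k (c * x)) =
      fun v : ℝ => cexp (↑(-2 * π * v * ξ) * I) * k (c * v) := by
    funext v; rw [mul_div_cancel_left₀ v hc.ne']
  rw [hfun] at h
  rw [h, abs_of_pos (inv_pos.mpr hc), Complex.real_smul, Complex.ofReal_inv]
  congr 1
  refine integral_congr_ae (Eventually.of_forall fun u => ?_)
  simp only
  congr 2
  push_cast
  field_simp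

/-- **Poisson summation for dilations**: `∑_{n ∈ ℤ} k(cn) = c⁻¹ ∑_{n ∈ ℤ} 𝓕k(n/c)` (`c > 0`).
[folklore] -/
theorem tsum_int_dilate_eq {c : ℝ} (hc : 0 < c) :
    ∑' n : ℤ, k (c * n) = (c⁻¹ : ℂ) * ∑' n : ℤ, 𝓕 (⇑k) (n / c) := by
  have h := SchwartzMap.tsum_eq_tsum_fourier (scaleSchwartz c hc.ne' k) 0
  simp only [zero_add, scaleSchwartz_apply, QuotientAddGroup.mk_zero, fourier_eval_zero, mul_one] at h
  rw [h, ← tsum_mul_left]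
  refine tsum_congr fun n => ?_
  rw [SchwartzMap.fourier_coe, fourier_scaleSchwartz k hc]

end Dilation

/-! ### The theta pair -/

section Theta

variable (k : SchwartzMap ℝ ℂ)

/-- The theta function `x ↦ ∑_{n ≠ 0} k(n x)` in the form `Σ(k ⊗ 1_Ẑ)(z(x))` (`x > 0`). [cite: Meyer2005, §5.7] -/
def thetaRest (k : SchwartzMap ℝ ℂ) (x : ℝ) : ℂ := meyerSum ℚ (ratTensor k) (posClass (Real.log x))

/-- `thetaRest k x = ∑_{n ≠ 0} k(n x)` for `x > 0`. [folklore] -/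
theorem thetaRest_eq {x : ℝ} (hx : 0 < x) : thetaRest k x = ∑' n : ℤ, if n = 0 then (0 : ℂ) else k (n * x) := by
  rw [thetaRest, meyerSum_ratTensor_eq, classNorm_posClass, Real.exp_log hx]

/-- Summability of `n ↦ k(xn)` over `ℤ` for even `k` and `x > 0`. [folklore] -/
theorem summable_int_comp_mul (heven : ∀ t, k (-t) = k t) {x : ℝ} (hx : 0 < x) :
    Summable fun n : ℤ => k (x * n) := by
  have h1 : Summable fun n : ℕ => k (x * n) := by
    rw [← summable_nat_add_iff 1]
    refine (summable_schwartz_comp_nat_mul k hx).congr fun n => ?_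
    rw [mul_comm]
  refine Summable.of_nat_of_neg_add_one h1 ?_
  refine (summable_schwartz_comp_nat_mul k hx).congr fun n => ?_
  rw [← heven]
  congr 1
  push_cast
  ring

/-- `∑_{n ∈ ℤ} k(x n) = k(0) + thetaRest k x` (`x > 0`, `k` even). [folklore] -/
theorem tsum_int_eq_add_thetaRest (heven : ∀ t, k (-t) = k t) {x : ℝ} (hx : 0 < x) :
    ∑' n : ℤ, k (x * n) = k 0 + thetaRest k x := by
  classical
  rw [thetaRest_eq k hx, (summable_int_comp_mul k heven hx).tsum_eq_add_tsum_ite 0]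
  simp only [Int.cast_zero, mul_zero]
  congr 1
  refine tsum_congr fun n => ?_
  split_ifs
  · rfl
  · rw [mul_comm]

/-- `thetaRest k` is unramified as a function on `C_ℚ` (through `Σ(k ⊗ 1_Ẑ)`). [folklore] -/
theorem meyerSum_ratTensor_unramified' :
    ∀ u ∈ integralFiniteUnits ℚ, ∀ x, meyerSum ℚ (ratTensor k) (x * finiteUnitClass ℚ u) = meyerSum ℚ (ratTensor k) x :=
  fun _ hu x => meyerSum_ratTensor_mul_finiteUnitClass (⇑k) hu x

/-- `thetaRest k` is continuous on `(0, ∞)`. [folklore] -/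
theorem continuousOn_thetaRest : ContinuousOn (thetaRest k) (Ioi 0) :=
  (continuous_apply_posClass_of_mem_weighted (meyerSum_ratTensor_unramified' k)
    (meyerSum_mem_ideleClassSchwartzWeighted_Ioi (ratTensor_mem_schwartzBruhatAdele k))).comp_continuousOn
    (Real.continuousOn_log.mono fun _ ht => ne_of_gt ht)

/-- `thetaRest k = O(x^r)` at `+∞` for every real `r`. [folklore] -/
theorem thetaRest_isBigO_atTop (r : ℝ) : thetaRest k =O[atTop] fun x : ℝ => x ^ r := by
  obtain ⟨C, hC⟩ := norm_apply_posClass_log_le_of_mem_weighted (meyerSum_ratTensor_unramified' k)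
    (meyerSum_mem_ideleClassSchwartzWeighted_Ioi (ratTensor_mem_schwartzBruhatAdele k)) (α := max 2 (-r))
    (lt_of_lt_of_le one_lt_two (le_max_left _ _))
  refine IsBigO.of_bound C ?_
  filter_upwards [eventually_ge_atTop (1 : ℝ)] with x hx
  have hx0 : 0 < x := by linarith
  refine (hC x hx0).trans ?_
  rw [Real.norm_of_nonneg (Real.rpow_nonneg hx0.le r)]
  have hC0 : 0 ≤ C := by
    have := (norm_nonneg _).trans (hC 1 one_pos)
    simpa using this
  have hexp : -(max 2 (-r)) ≤ r := by
    have := le_max_right 2 (-r)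
    linarith
  exact mul_le_mul_of_nonneg_left (Real.rpow_le_rpow_of_exponent_le hx hexp) hC0

/-- The Fourier transform of an even Schwartz function is even. [folklore] -/
theorem fourier_even (heven : ∀ t, k (-t) = k t) (ξ : ℝ) : 𝓕 (⇑k) (-ξ) = 𝓕 (⇑k) ξ := by
  rw [Real.fourier_real_eq_integral_exp_smul, Real.fourier_real_eq_integral_exp_smul]
  rw [← integral_neg_eq_self]
  refine integral_congr_ae (Eventually.of_forall fun v => ?_)
  simp only [heven]
  congr 2
  push_cast
  ring

/-- `𝓕k(0) = ∫ k`. [folklore] -/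
theorem fourier_apply_zero : 𝓕 (⇑k) 0 = ∫ t : ℝ, k t := by
  rw [Real.fourier_real_eq_integral_exp_smul]
  refine integral_congr_ae (Eventually.of_forall fun v => ?_)
  simp

/-- `∫ 𝓕k = k(0)` (Fourier inversion for Schwartz functions). [folklore] -/
theorem integral_fourier_eq : ∫ ξ : ℝ, 𝓕 (⇑k) ξ = k 0 := by
  have h0 : (𝓕⁻ (𝓕 k : SchwartzMap ℝ ℂ) : SchwartzMap ℝ ℂ) = k := FourierTransform.fourierInv_fourier_eq k
  have h : ((𝓕⁻ (𝓕 k : SchwartzMap ℝ ℂ) : SchwartzMap ℝ ℂ) : ℝ → ℂ) 0 = k 0 := by rw [h0]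
  rw [← h]
  rw [SchwartzMap.fourierInv_coe, Real.fourierInv_eq']
  refine integral_congr_ae (Eventually.of_forall fun v => ?_)
  simp [SchwartzMap.fourier_coe]

/-- **The theta `WeakFEPair`** of an even Schwartz function: `f = Θ_k`, `g = Θ_{𝓕k}` on `(0, ∞)`,
weight `1`, root number `1`, constant terms `k(0)`, `𝓕k(0)`. [cite: Meyer2005, §5.7] -/
def thetaPair (heven : ∀ t, k (-t) = k t) : WeakFEPair ℂ where
  f := fun x => k 0 + thetaRest k x
  g := fun x => (𝓕 k : SchwartzMap ℝ ℂ) 0 + thetaRest (𝓕 k) x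
  k := 1
  ε := 1
  f₀ := k 0
  g₀ := (𝓕 k : SchwartzMap ℝ ℂ) 0
  hf_int := (continuousOn_const.add (continuousOn_thetaRest k)).locallyIntegrableOn measurableSet_Ioi
  hg_int := (continuousOn_const.add (continuousOn_thetaRest (𝓕 k))).locallyIntegrableOn measurableSet_Ioi
  hk := one_pos
  hε := one_ne_zero
  h_feq := fun x hx => by
    have hx' : (0 : ℝ) < 1 / x := by have := mem_Ioi.mp hx; positivity
    have hevenF : ∀ t, (𝓕 k : SchwartzMap ℝ ℂ) (-t) = (𝓕 k : SchwartzMap ℝ ℂ) t := fun t => by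
      rw [SchwartzMap.fourier_coe]; exact fourier_even k heven t
    rw [← tsum_int_eq_add_thetaRest k heven hx', ← tsum_int_eq_add_thetaRest (𝓕 k) hevenF (mem_Ioi.mp hx),
      tsum_int_dilate_eq k hx', Real.rpow_one, one_mul, smul_eq_mul]
    congr 1
    · push_cast; field_simp
    · refine tsum_congr fun n => ?_
      rw [SchwartzMap.fourier_coe]
      field_simp
  hf_top := fun r => by
    refine (thetaRest_isBigO_atTop k r).congr' ?_ EventuallyEq.rfl
    filter_upwards with x
    simp
  hg_top := fun r => by
    refine (thetaRest_isBigO_atTop (𝓕 k) r).congr' ?_ EventuallyEq.rfl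
    filter_upwards with x
    simp

/-- `Λ_k(z) = 2 ζ(z) Mk(z)` for `Re z > 1`. [cite: Meyer2005, §5.7] -/
theorem thetaPair_Λ_eq (heven : ∀ t, k (-t) = k t) {z : ℂ} (hz : 1 < z.re) :
    (thetaPair k heven).Λ z = 2 * riemannZeta z * mellin (fun t : ℝ => k t) z := by
  have h := ((thetaPair k heven).hasMellin (s := z) (by change (1 : ℝ) < z.re; exact hz)).2
  rw [← h, ← mellin_tsum_int_ite k heven hz]
  refine mellin_congr_Ioi' (fun t ht => ?_) z
  change k 0 + thetaRest k t - k 0 = _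
  rw [add_sub_cancel_left, thetaRest_eq k ht]

/-- The Fourier transform as an even Schwartz function. [folklore] -/
theorem fourier_schwartz_even (heven : ∀ t, k (-t) = k t) (t : ℝ) :
    (𝓕 k : SchwartzMap ℝ ℂ) (-t) = (𝓕 k : SchwartzMap ℝ ℂ) t := by
  rw [SchwartzMap.fourier_coe]; exact fourier_even k heven t

/-- `Λ'_k(z) = 2 ζ(z) M(𝓕k)(z)` for `Re z > 1` (the symmetric pair). [cite: Meyer2005, §5.7] -/
theorem thetaPair_symm_Λ_eq (heven : ∀ t, k (-t) = k t) {z : ℂ} (hz : 1 < z.re) :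
    (thetaPair k heven).symm.Λ z = 2 * riemannZeta z * mellin (fun t : ℝ => (𝓕 k : SchwartzMap ℝ ℂ) t) z := by
  have h := ((thetaPair k heven).symm.hasMellin (s := z) (by change (1 : ℝ) < z.re; exact hz)).2
  rw [← h, ← mellin_tsum_int_ite (𝓕 k) (fourier_schwartz_even k heven) hz]
  refine mellin_congr_Ioi' (fun t ht => ?_) z
  change (𝓕 k : SchwartzMap ℝ ℂ) 0 + thetaRest (𝓕 k) t - (𝓕 k : SchwartzMap ℝ ℂ) 0 = _
  rw [add_sub_cancel_left, thetaRest_eq (𝓕 k) ht]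

/-- **THE THETA FUNCTIONAL EQUATION** for an even Schwartz function with `k(0) = 0 = ∫ k`: the
functions `2 ζ(z) Mk(z)` and `2 ζ(z) M(𝓕k)(z)` (`Re z > 1`) have entire continuations `Λ₁, Λ₂` with
`Λ₁(1 - z) = Λ₂(z)`. [cite: Meyer2005, §5.7] -/
theorem exists_entire_thetaFE (heven : ∀ t, k (-t) = k t) (h0 : k 0 = 0) (hint : ∫ t : ℝ, k t = 0) :
    ∃ Λ₁ Λ₂ : ℂ → ℂ, Differentiable ℂ Λ₁ ∧ Differentiable ℂ Λ₂ ∧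
      (∀ z : ℂ, 1 < z.re → Λ₁ z = 2 * riemannZeta z * mellin (fun t : ℝ => k t) z) ∧
      (∀ z : ℂ, 1 < z.re → Λ₂ z = 2 * riemannZeta z * mellin (fun t : ℝ => (𝓕 k : SchwartzMap ℝ ℂ) t) z) ∧
      ∀ z : ℂ, Λ₁ (1 - z) = Λ₂ z := by
  set P := thetaPair k heven with hP
  have hf₀ : P.f₀ = 0 := h0
  have hg₀ : P.g₀ = 0 := by
    change (𝓕 k : SchwartzMap ℝ ℂ) 0 = 0
    rw [SchwartzMap.fourier_coe, fourier_apply_zero, hint]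
  refine ⟨P.Λ, P.symm.Λ, fun z => P.differentiableAt_Λ (Or.inr hf₀) (Or.inr hg₀),
    fun z => P.symm.differentiableAt_Λ (Or.inr hg₀) (Or.inr hf₀), fun z hz => thetaPair_Λ_eq k heven hz,
    fun z hz => thetaPair_symm_Λ_eq k heven hz, fun z => ?_⟩
  have h := P.functional_equation z
  change P.Λ ((1 : ℝ) - z) = (1 : ℂ) • P.symm.Λ z at h
  rw [one_smul] at h
  exact_mod_cast h

end Theta

end Literature.NumberTheory.Automorphic.Meyer
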